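import Literature.NumberTheory.EllipticCurves.MazurTateElementCoeffField
import Literature.NumberTheory.EllipticCurves.NewformPeriodsCoeffField
import Literature.NumberTheory.EllipticCurves.EisensteinNewformLevelRaisingDeligneSerreLiftProofs
import HarnessLib

/-!
# Cohomological plus periods exist (Pollack–Weston 2011, Def. 2.1 "such periods clearly always exist")

Route `ResidualThetaTransportAtTwo`, support item `CohomologicalPlusPeriodSupply`
(stmt-BirchSwinnertonDyer-22892) = the registered stub `stub_exists_cohomologicalPlusPeriod` (coh) of
the cruxes K0⁺ `HeckeThetaPartnerAdicAtTwo` (stmt-BirchSwinnertonDyer-20690) and Kan⁺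
`ThetaLayerLambdaCongruenceAtTwo` (stmt-BirchSwinnertonDyer-20688).  THEOREMS ONLY (no definition, no
named fact, no `sorry`).

**Main result** `exists_isCohomologicalPlusPeriod`: for a newform `g ∈ S₂(Γ₀(N))` (`IsNewform0`), a
prime `p` and a ring embedding `ι : K_g → ℚ̄_p` of its coefficient field there is a COHOMOLOGICAL plus
period `Ω` (`IsCohomologicalPlusPeriod g ι Ω`, PW Def. 2.1: a Shimura period such that every
`ι [r]⁺_{g,Ω}` has norm `≤ 1` and one of them has norm `1`).  The route decl `CohomologicalPlusPeriodSupply`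
(`p = 2`) BY NAME is the one-line corollary `cohomologicalPlusPeriodSupply_proof` of the companion file
`…CohomologicalPlusPeriodSupply.lean`.

Proof (PW: "Such periods clearly always exist"), entirely from tree theorems:
1. a Shimura period `Ω₀` exists (`IsNewform0.exists_plusSymbol_eq_mul`, Shimura 1977 Thm. 1);
2. MANIN'S TRICK (`exists_chain`, continued fractions): every modular symbol `{∞, r}_g` is an
   integral combination of the finitely many M-symbols `{k0, k∞}_g`, `k` running over coset
   representatives of `Γ₀(N)` in `SL(2, ℤ)`; taking real parts (`plusSymbol_eq_re_holds`, the
   coefficients of a newform are real) every `[r]⁺_{g,Ω₀}` is an integral combination of finitely many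
   differences `[r₁]⁺ - [r₂]⁺`, so (ultrametric inequality) `‖ι [r]⁺‖ ≤ B`, the largest norm of these
   finitely many generators;
3. some plus symbol is non-zero (`exists_re_cuspSymbol_ne_zero`: the periods of `g ≠ 0` do not all lie
   on the imaginary axis), so `B > 0`, and the generator of norm `B` is `[r₁]⁺ - [r₂]⁺` with one of
   `‖ι [rᵢ]⁺‖` equal to `B` (ultrametric inequality again);
4. rescale: `Ω = [rᵢ]⁺_{g,Ω₀} · Ω₀` ("well-defined up to scaling by elements `α ∈ K_f`").

References: [PollackWeston2011MT] Def. 2.1; [Shimura1977] Thm. 1; [Manin1972] Thm. 1.6, §1.7;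
[CremonaAlgorithms1997] §2.2–2.3, §2.8.
-/

set_option autoImplicit false
set_option linter.dupNamespace false

noncomputable section

open scoped MatrixGroups ModularForm
open CongruenceSubgroup Matrix.SpecialLinearGroup ModularGroup
open Literature.NumberTheory.EllipticCurves Literature.NumberTheory.EllipticCurves.ModularForms

namespace Summit.BirchSwinnertonDyer.BirchSwinnertonDyer.Theorems.CohomologicalPeriod

variable {N : ℕ} [NeZero N] {g : CuspForm (Gamma0 N) 2} {p : ℕ} [Fact p.Prime]

/-! ### Non-vanishing of a plus symbol -/

/-- **Some plus symbol of a newform is non-zero**: `g ≠ 0`, so some period `{∞, γ∞}_g` has non-zero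
real part (`exists_re_cuspSymbol_ne_zero`), and for real Fourier coefficients
`[r]⁺ = re {∞, r}` (`plusSymbol_eq_re_holds`). [cite: CremonaAlgorithms1997, §2.8] -/
theorem exists_plusSymbol_ne_zero (hg : IsNewform0 g) : ∃ r : ℚ, plusSymbol g r ≠ 0 := by
  have hg0 : g ≠ 0 := IsNormalized.ne_zero_gamma0 hg.2.2
  obtain ⟨γ, hγ⟩ := exists_re_cuspSymbol_ne_zero g hg0
  unfold cuspSymbol at hγ
  split_ifs at hγ with h10
  · simp at hγ
  · set r : ℚ := (((γ : SL(2, ℤ)) 0 0 : ℤ) : ℚ) / (((γ : SL(2, ℤ)) 1 0 : ℤ) : ℚ) with hr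
    refine ⟨r, fun h0 => hγ ?_⟩
    have h := plusSymbol_eq_re_holds g hg.cuspCoeff_im_eq_zero r
    rw [h0] at h
    exact_mod_cast h.symm

/-! ### Manin's trick for the `K_g`-valued plus symbols -/

/-- The M-symbol of a coset evaluated at `g`: `m(q)(g) = {k⁻¹0, k⁻¹∞}_g` for the chosen representative
`k = q.out`. [folklore] -/
theorem msymbol_apply_eq (q : Gamma0Coset N) : msymbol N q g = msymbolSL g (q.out)⁻¹ := by
  conv_lhs => rw [← QuotientGroup.out_eq' q]
  rfl

/-- **Manin's trick for plus symbols.** For a Shimura period `Ω` of `g` (real coefficients) there is a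
function `ρ : SL(2, ℤ) → K_g` — `ρ k = re {∞, k∞}_g / Ω`, which is `0` (if `k∞ = ∞`) or the plus symbol
`[k∞]⁺_{g,Ω}` — such that every `[r]⁺_{g,Ω}` is an INTEGRAL combination of the finitely many
differences `ρ(k_q⁻¹) - ρ(k_q⁻¹S)`, `k_q` the chosen representatives of `SL(2, ℤ)/Γ₀(N)`: Manin's
continued-fraction expression of `{∞, r}` through the M-symbols `{k0, k∞}` (`exists_chain`), real
parts taken (`plusSymbol_eq_re_holds`). [cite: CremonaAlgorithms1997, §2.3] -/
theorem exists_plusSymbolK_eq_sum {Ω : ℂ} (hΩ : IsPlusPeriod g Ω) (hreal : ∀ n, (cuspCoeff g n).im = 0) :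
    ∃ ρ : SL(2, ℤ) → coeffField g,
      (∀ k, ρ k = 0 ∨ ∃ r : ℚ, ρ k = plusSymbolK g Ω r) ∧
      ∀ r : ℚ, ∃ c : Gamma0Coset N → ℤ,
        plusSymbolK g Ω r = ∑ q, (c q : coeffField g) * (ρ (q.out)⁻¹ - ρ ((q.out)⁻¹ * S)) := by
  classical
  -- `ρ k = re {∞, k∞}_g / Ω`
  let ρ : SL(2, ℤ) → coeffField g := fun k =>
    if k 1 0 = 0 then 0 else plusSymbolK g Ω (((k 0 0 : ℤ) : ℚ) / ((k 1 0 : ℤ) : ℚ))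
  have coe_ρ : ∀ k : SL(2, ℤ), ((ρ k : coeffField g) : ℂ) = ((inftySymbol g k).re : ℂ) / Ω := by
    intro k
    simp only [ρ, inftySymbol]
    split_ifs with h
    · simp
    · rw [IsPlusPeriod.coe_plusSymbolK g hΩ, plusSymbol_eq_re_holds g hreal]
  refine ⟨ρ, fun k => ?_, fun r => ?_⟩
  · simp only [ρ]
    split_ifs
    · exact Or.inl rfl
    · exact Or.inr ⟨_, rfl⟩
  obtain ⟨c, hcint, hcm, -⟩ := exists_chain (N := N) (cuspMatrix r)
  choose m hm using hcint
  refine ⟨m, ?_⟩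
  -- the identity `{∞, r}_g = ∑_q c_q {k_q⁻¹0, k_q⁻¹∞}_g` in `ℂ`
  have key : modularSymbol g r = ∑ q : Gamma0Coset N, (m q : ℂ) * msymbolSL g (q.out)⁻¹ := by
    have h1 := LinearMap.congr_fun hcm g
    rw [inftyFunctional_cuspMatrix_apply] at h1
    rw [← h1, msymbolMap, Fintype.linearCombination_apply, LinearMap.sum_apply]
    refine Finset.sum_congr rfl fun q _ => ?_
    rw [LinearMap.smul_apply, hm q, msymbol_apply_eq, Rat.smul_def]
    push_cast
    rfl
  -- real parts, divided by `Ω`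
  apply Subtype.ext
  rw [IsPlusPeriod.coe_plusSymbolK g hΩ, plusSymbol_eq_re_holds g hreal, key, Complex.re_sum,
    Complex.ofReal_sum, Finset.sum_div]
  push_cast
  refine Finset.sum_congr rfl fun q _ => ?_
  rw [coe_ρ, coe_ρ, msymbolSL]
  simp only [Complex.sub_re, Complex.mul_re, Complex.intCast_re, Complex.intCast_im, zero_mul,
    sub_zero]
  push_cast
  ring

/-! ### Norm bounds along `ι` -/

omit [NeZero N] in
/-- An integral combination of elements of norm `≤ B` has norm `≤ B` (ultrametric inequality in
`ℚ̄_p`; `DeligneSerreLift.norm_intCast_le_one`). [folklore] -/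
theorem norm_sum_intCast_mul_le {α : Type*} (s : Finset α) (ι : coeffField g →+* PadicAlgCl p)
    (c : α → ℤ) (x : α → coeffField g) {B : ℝ} (hB : 0 ≤ B) (hx : ∀ a ∈ s, ‖ι (x a)‖ ≤ B) :
    ‖ι (∑ a ∈ s, (c a : coeffField g) * x a)‖ ≤ B := by
  rw [map_sum]
  refine IsUltrametricDist.norm_sum_le_of_forall_le_of_nonneg hB fun a ha => ?_
  rw [map_mul, map_intCast, norm_mul]
  exact (mul_le_of_le_one_left (norm_nonneg _) (DeligneSerreLift.norm_intCast_le_one _)).trans (hx a ha)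

/-- **The sup of the norms `‖ι [r]⁺_{g,Ω}‖` is positive and attained**: there are `B > 0` and `r₀` with
`‖ι [r]⁺‖ ≤ B` for all `r` and `‖ι [r₀]⁺‖ = B` (Manin's trick + ultrametric inequality + non-vanishing
of a plus symbol). [cite: CremonaAlgorithms1997, §2.3] -/
theorem exists_norm_plusSymbolK_eq_max (hg : IsNewform0 g) (ι : coeffField g →+* PadicAlgCl p) {Ω : ℂ}
    (hΩ : IsPlusPeriod g Ω) :
    ∃ (B : ℝ) (r₀ : ℚ), 0 < B ∧ (∀ r : ℚ, ‖ι (plusSymbolK g Ω r)‖ ≤ B) ∧ ‖ι (plusSymbolK g Ω r₀)‖ = B := by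
  classical
  obtain ⟨ρ, hρ, hsum⟩ := exists_plusSymbolK_eq_sum hΩ hg.cuspCoeff_im_eq_zero
  -- the bound `B` = largest norm of a generator
  obtain ⟨q₀, -, hq₀⟩ := Finset.exists_max_image (Finset.univ : Finset (Gamma0Coset N))
    (fun q => ‖ι (ρ (q.out)⁻¹ - ρ ((q.out)⁻¹ * S))‖) Finset.univ_nonempty
  set B : ℝ := ‖ι (ρ (q₀.out)⁻¹ - ρ ((q₀.out)⁻¹ * S))‖ with hB
  have hB0 : 0 ≤ B := norm_nonneg _
  have hle : ∀ r : ℚ, ‖ι (plusSymbolK g Ω r)‖ ≤ B := by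
    intro r
    obtain ⟨c, hc⟩ := hsum r
    rw [hc]
    exact norm_sum_intCast_mul_le _ ι c _ hB0 fun q hq => hq₀ q hq
  -- `B > 0`
  obtain ⟨r₁, hr₁⟩ := exists_plusSymbol_ne_zero hg
  have hne : plusSymbolK g Ω r₁ ≠ 0 := by
    intro h0
    have h1 : ((plusSymbolK g Ω r₁ : coeffField g) : ℂ) = 0 := by rw [h0]; rfl
    rw [IsPlusPeriod.coe_plusSymbolK g hΩ, div_eq_zero_iff] at h1
    exact h1.elim hr₁ hΩ.1
  have hBpos : 0 < B := lt_of_lt_of_le (norm_pos_iff.mpr ((map_ne_zero ι).mpr hne)) (hle r₁)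
  refine ⟨B, ?_⟩
  -- the generator of norm `B` is `ρ a - ρ b`; one of them has norm `≥ B`, and it is a plus symbol
  have hmax : B ≤ max ‖ι (ρ (q₀.out)⁻¹)‖ ‖ι (ρ ((q₀.out)⁻¹ * S))‖ := by
    rw [hB, map_sub, sub_eq_add_neg]
    refine (IsUltrametricDist.norm_add_le_max _ _).trans ?_
    rw [norm_neg]
  have hone : ∀ k : SL(2, ℤ), B ≤ ‖ι (ρ k)‖ → ∃ r₀ : ℚ, ‖ι (plusSymbolK g Ω r₀)‖ = B := by
    intro k hk
    rcases hρ k with h | ⟨r, h⟩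
    · rw [h, map_zero, norm_zero] at hk
      exact absurd hk (not_le.mpr hBpos)
    · rw [h] at hk
      exact ⟨r, le_antisymm (hle r) hk⟩
  rcases le_max_iff.mp hmax with h | h
  · obtain ⟨r₀, hr₀⟩ := hone _ h
    exact ⟨r₀, hBpos, hle, hr₀⟩
  · obtain ⟨r₀, hr₀⟩ := hone _ h
    exact ⟨r₀, hBpos, hle, hr₀⟩

/-! ### Rescaling to a cohomological period -/

omit [NeZero N] in
/-- **Rescaling a Shimura period by the plus symbol of largest norm gives a cohomological period.**
If `Ω` is a Shimura period and `α = [r₀]⁺_{g,Ω}` dominates every `ι [r]⁺_{g,Ω}` in norm and is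
non-zero, then `α · Ω` is a cohomological plus period along `ι` (PW Def. 2.1, "well-defined up to
scaling"). [cite: PollackWeston2011MT, Def. 2.1] -/
theorem isCohomologicalPlusPeriod_mul (ι : coeffField g →+* PadicAlgCl p) {Ω : ℂ} (hΩ : IsPlusPeriod g Ω)
    {r₀ : ℚ} (hα0 : plusSymbolK g Ω r₀ ≠ 0)
    (hle : ∀ r : ℚ, ‖ι (plusSymbolK g Ω r)‖ ≤ ‖ι (plusSymbolK g Ω r₀)‖) :
    IsCohomologicalPlusPeriod g ι ((plusSymbolK g Ω r₀ : ℂ) * Ω) := by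
  have hαC : ((plusSymbolK g Ω r₀ : coeffField g) : ℂ) ≠ 0 := fun h => hα0 (Subtype.ext h)
  have hP' : IsPlusPeriod g ((plusSymbolK g Ω r₀ : ℂ) * Ω) :=
    IsPlusPeriod.mul g hΩ (plusSymbolK g Ω r₀).2 hαC
  have hsym : ∀ r : ℚ, plusSymbolK g ((plusSymbolK g Ω r₀ : ℂ) * Ω) r =
      plusSymbolK g Ω r / plusSymbolK g Ω r₀ := by
    intro r
    apply Subtype.ext
    rw [IsPlusPeriod.coe_plusSymbolK g hP', IntermediateField.coe_div]
    simp only [IsPlusPeriod.coe_plusSymbolK g hΩ]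
    have hΩ0 := hΩ.1
    field_simp
  have hpos : 0 < ‖ι (plusSymbolK g Ω r₀)‖ := norm_pos_iff.mpr ((map_ne_zero ι).mpr hα0)
  refine ⟨hP', fun r => ?_, ⟨r₀, ?_⟩⟩
  · rw [hsym, map_div₀, norm_div]
    exact div_le_one_of_le₀ (hle r) (norm_nonneg _)
  · rw [hsym, map_div₀, norm_div]
    exact div_self hpos.ne'

/-! ### The main theorem -/

/-- **Cohomological plus periods exist** (Pollack–Weston 2011, Def. 2.1: "Such periods clearly
always exist for each `f` and are well-defined up to scaling by elements `α ∈ K_f` such that the image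
of `α` in `ℚ̄_p` is a `p`-adic unit"): for a newform `g ∈ S₂(Γ₀(N))`, a prime `p` and an embedding
`ι : K_g → ℚ̄_p` there is `Ω` with `IsCohomologicalPlusPeriod g ι Ω`.  See the module docstring for
the proof. [cite: PollackWeston2011MT, Def. 2.1] -/
theorem exists_isCohomologicalPlusPeriod (hg : IsNewform0 g) (ι : coeffField g →+* PadicAlgCl p) :
    ∃ Ω : ℂ, IsCohomologicalPlusPeriod g ι Ω := by
  -- a Shimura period
  obtain ⟨Ω₀, hΩ₀0, hΩ₀⟩ := hg.exists_plusSymbol_eq_mul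
  have hP : IsPlusPeriod g (Ω₀ : ℂ) := by
    refine ⟨Complex.ofReal_ne_zero.mpr hΩ₀0, fun r => ?_⟩
    obtain ⟨q, hq, hqr⟩ := hΩ₀ r
    rw [hqr, mul_div_cancel_right₀ q (Complex.ofReal_ne_zero.mpr hΩ₀0)]
    exact hq
  -- the plus symbol of largest norm
  obtain ⟨B, r₀, hB, hle, hr₀⟩ := exists_norm_plusSymbolK_eq_max hg ι hP
  have hα0 : plusSymbolK g (Ω₀ : ℂ) r₀ ≠ 0 := fun h => by
    rw [h, map_zero, norm_zero] at hr₀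
    exact hB.ne hr₀
  exact ⟨_, isCohomologicalPlusPeriod_mul ι hP hα0 (fun r => hr₀ ▸ hle r)⟩

end Summit.BirchSwinnertonDyer.BirchSwinnertonDyer.Theorems.CohomologicalPeriod

end
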